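import Literature.AnabelianGeometry.SemiGraphs.TemperedGroups
import Literature.AlgebraicGeometry.Frobenioids.QuasiTemperoidConnected
import HarnessLib

/-!
# [SemiAnbd] Rmk 3.1.2: `B^temp(−)` along an isomorphism of topological groups

Mochizuki, *Semi-graphs of anabelioids*, Publ. RIMS **42** (2006) 221–322, §3, Remark 3.1.2,
manuscript pp. 33–34 [cite: MochizukiSemiAnbd2006, Rmk 3.1.2 pp.33-34]: "any continuous
homomorphism `Π → Π'` determines … a morphism `B^temp(Π) → B^temp(Π')`" (the pull-back functor
`BTemp.res` of `TemperedGroups.lean`); in particular an ISOMORPHISM of topological groups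
`e : Π ≃ Π'` identifies `B^temp(Π')` with `B^temp(Π)`.  This file records that equivalence
(`BTemp.resEquiv e : BTemp Π' ≌ BTemp Π`, functor `BTemp.res e`, inverse `BTemp.res e⁻¹`, unit and
counit the identity maps) — the transport used in [SemiAnbd] §3 whenever a vertex group of a
covering semi-graph of anabelioids is identified with the stabiliser of a point (Def. 3.5 (i) p. 37,
Prop. 3.6 (v) p. 39; abc-iut G10 item Prop 3.6 (v)).  Plain bookkeeping; nothing is strengthened.
-/

open CategoryTheory Topology

namespace Literature.AnabelianGeometry.SemiGraphs

open Literature.AlgebraicGeometry.Frobenioids.QuasiTemperoid.BTempConnected (hom_ext_apply)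

universe u

namespace BTemp

variable {G : Type u} [Group G] [TopologicalSpace G] {H : Type u} [Group H] [TopologicalSpace H]

/-- The object `B^temp(ψ)(B^temp(φ)(X))` for homomorphisms with `φ (ψ g) = g` is `X` again: the
identity map is an isomorphism. [cite: MochizukiSemiAnbd2006, Rmk 3.1.2 pp.33-34] -/
noncomputable def resResIso (φ : G →ₜ* H) (ψ : H →ₜ* G) (h : ∀ x : H, φ (ψ x) = x) (X : BTemp H) :
    X ≅ (BTemp.res ψ).obj ((BTemp.res φ).obj X) where
  hom := ObjectProperty.homMk
    { hom := TypeCat.ofHom fun x : X.obj.V => (x : X.obj.V)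
      comm := fun g => by
        apply ConcreteCategory.hom_ext
        intro x
        change X.obj.ρ g x = X.obj.ρ (φ (ψ g)) x
        rw [h] }
  inv := ObjectProperty.homMk
    { hom := TypeCat.ofHom fun x : X.obj.V => (x : X.obj.V)
      comm := fun g => by
        apply ConcreteCategory.hom_ext
        intro x
        change X.obj.ρ (φ (ψ g)) x = X.obj.ρ g x
        rw [h] }
  hom_inv_id := hom_ext_apply fun _ => rfl
  inv_hom_id := hom_ext_apply fun _ => rfl

/-- **`B^temp(−)` along an isomorphism of topological groups**: `e : Π ≃ Π'` gives
`B^temp(Π') ≌ B^temp(Π)`, with functor `B^temp(e)` and inverse `B^temp(e⁻¹)`.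
[cite: MochizukiSemiAnbd2006, Rmk 3.1.2 pp.33-34] -/
noncomputable def resEquiv (e : G ≃ₜ* H) : BTemp H ≌ BTemp G where
  functor := BTemp.res (e : G →ₜ* H)
  inverse := BTemp.res (e.symm : H →ₜ* G)
  unitIso := NatIso.ofComponents
    (fun X => resResIso (e : G →ₜ* H) (e.symm : H →ₜ* G) (fun x => e.apply_symm_apply x) X)
    (fun _ => hom_ext_apply fun _ => rfl)
  counitIso := (NatIso.ofComponents
    (fun Y => resResIso (e.symm : H →ₜ* G) (e : G →ₜ* H) (fun x => e.symm_apply_apply x) Y)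
    (fun _ => hom_ext_apply fun _ => rfl)).symm
  functor_unitIso_comp _ := hom_ext_apply fun _ => rfl

end BTemp

end Literature.AnabelianGeometry.SemiGraphs
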